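import Summits.BirchSwinnertonDyer.Rank1Residual.X11b.PerfectPairingAnnihilators
import HarnessLib

/-!
# Route `GenusKolyvaginAtTwo`, crux L_T `PowDvdShaCardAtTwoRT` (stmt-BirchSwinnertonDyer-23242), LINE 18 stub L, bottom rung:
# THE ORDER-8 COISOTROPIC CONDITION `M = Tr ⊔ V[2]` AT A DEEP OWN PRIME — pure algebra of the LEAD's §8

Width seat `bsd-line-gk2-p4` g18 (cell `bsd-f1-sign2`), `--supports 23242 --as helper`.  THEOREMS ONLY (finite abelian groups and a
bi-additive pairing; no definition, no named fact, no `sorry`; standard axioms).  BSD is NOT proved by any of this; neither is the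
crux nor stub L.

WHY (LEAD memo `Cruxes/PowDvdShaCardAtTwoRT/Lines/plus-descent-lead-g16.md` §2, §7 (i), §8).  At a deep own prime `ℓ ∈ t` of the
k-minimal witness the bottom-rung engine needs a local condition `M_ℓ ≤ V := H¹(ℚ_ℓ, E^ε[4])` (`#V = 16`, `V = H¹_f ⊕ H¹_tr`, both
summands cyclic of order `4` and isotropic for the local Tate pairing `b`) such that (1) `⟨2•Z, y⟩ = 0` for all `Z, y ∈ M_ℓ` (the
`t`-terms of the reciprocity for `X = 2•desc c₂(nℓ′)` vanish), (2) `#M_ℓ = 8` (or just `≥ 8`: the numerical hypothesis of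
`…RTOrderFourAuxiliaryConstrained.exists_mem_kummerOutside_four_two_nsmul_ne_zero_of_free_of_eight_le`), (3) `{}^⊥M_ℓ ≤ M_ℓ`
(coisotropic, so that the dual solution group is the smaller one).  The LEAD's §8 takes `M_ℓ := (2•)⁻¹ H¹_tr = H¹_tr ⊕ H¹_f[2]`.
This file proves (1)–(3) ABSTRACTLY for **`M := Tr ⊔ V[2]`** (`= Tr ⊔ F[2]` when `V = F ⊕ Tr`; `= (2•)⁻¹(2•Tr)`), from the
ISOTROPY of `Tr` alone for (1), from `#Tr = 4` and ONE `2`-torsion element outside `Tr` for (2), and from `{}^⊥Tr = Tr` for (3) —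
so that the only arithmetic left to type at a deep own prime is the transverse subgroup `H¹_tr` itself (isotropic, order `4`,
meeting `H¹_f` trivially: McCallum Lemma 5.3 over `ℚ_ℓ`, tree `lemma_5_3_rat_two…`, I7 `…RTTransverseIsotropicInv`).
* §1 `pairing_two_nsmul_eq_zero_of_mem_sup_torsionBy` — `Tr` isotropic ⟹ `b (2•z) y = 0` for `z, y ∈ Tr ⊔ V[2]` (bilinearity);
  `mem_sup_torsionBy_iff_exists` (`z ∈ Tr ⊔ V[2] ↔ ∃ t ∈ Tr, 2•z = 2•t`), `mem_sup_torsionBy_of_two_nsmul_eq` (`2•z ∈ 2•Tr ⟹ z ∈ M`).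
* §2 `eight_le_natCard_sup_torsionBy` — `#Tr = 4`, `∃ v ∈ V[2] ∖ Tr` ⟹ `8 ≤ #(Tr ⊔ V[2])`; `natCard_sup_torsionBy_le_eight` — `#V = 16`,
  `Tr ⊔ V[2] ≠ ⊤` ⟹ `≤ 8`; hence `= 8`.
* §3 (perfect `ℤ/n`-valued pairing, `n•V = 0`) `annLeft_sup_torsionBy_le` — `{}^⊥Tr = Tr ⟹ {}^⊥(Tr ⊔ V[2]) ≤ Tr ≤ Tr ⊔ V[2]`;
  `annLeft_eq_self_of_isotropic_of_card` — isotropic with `#Tr·#Tr = #V` ⟹ `{}^⊥Tr = Tr`; `two_nsmul_mem_annLeft_torsionBy`.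
HONEST FRAMING: folklore finite-group bookkeeping; closes nothing.  BSD is NOT proved by any of this.

References: [McCallumLMS1991] §5 Lemma 5.3 and proof of Prop. 5.2 (13); [MilneADT2006] Ch. I Prop. 0.19, Cor. 2.3.
-/

set_option autoImplicit false
-- `Summit.<P>.<Sub>` repeats `BirchSwinnertonDyer` by the tree's layout convention (D-0017)
set_option linter.dupNamespace false

namespace Summit.BirchSwinnertonDyer.BirchSwinnertonDyer.Theorems.GenusExact.CoisotropicEight

open Function AddSubgroup
open Summit.BirchSwinnertonDyer.Rank1Residual.X11b.FiniteDuality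

/-! ## §1 The vanishing `⟨2•z, y⟩ = 0` on `Tr ⊔ V[2]` from the isotropy of `Tr` -/

section Vanishing

variable {V : Type*} [AddCommGroup V] {R : Type*} [AddCommGroup R]

/-- `z ∈ Tr ⊔ V[2]` iff `2•z = 2•t` for some `t ∈ Tr`. [folklore] -/
theorem mem_sup_torsionBy_iff_exists (Tr : AddSubgroup V) (z : V) :
    z ∈ Tr ⊔ AddSubgroup.torsionBy V 2 ↔ ∃ t ∈ Tr, (2 : ℕ) • z = 2 • t := by
  constructor
  · intro hz
    obtain ⟨t, ht, a, ha, rfl⟩ := AddSubgroup.mem_sup.mp hz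
    refine ⟨t, ht, ?_⟩
    have ha0 : (2 : ℕ) • a = 0 := by
      have := (Submodule.mem_torsionBy_iff (R := ℤ) (2 : ℤ) a).mp ha
      rwa [← natCast_zsmul, Nat.cast_ofNat]
    rw [smul_add, ha0, add_zero]
  · rintro ⟨t, ht, h⟩
    refine AddSubgroup.mem_sup.mpr ⟨t, ht, z - t, ?_, add_sub_cancel t z⟩
    refine (Submodule.mem_torsionBy_iff (R := ℤ) (2 : ℤ) (z - t)).mpr ?_
    change (2 : ℤ) • (z - t) = 0
    rw [← Nat.cast_ofNat, natCast_zsmul, smul_sub, h, sub_self]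

/-- `2•z ∈ 2•Tr` (as `2•z = 2•t`, `t ∈ Tr`) puts `z` in `Tr ⊔ V[2]`; in particular `Tr ⊔ V[2] = (2•)⁻¹(2•Tr)`. [folklore] -/
theorem mem_sup_torsionBy_of_two_nsmul_eq {Tr : AddSubgroup V} {z t : V} (ht : t ∈ Tr) (h : (2 : ℕ) • z = 2 • t) :
    z ∈ Tr ⊔ AddSubgroup.torsionBy V 2 :=
  (mem_sup_torsionBy_iff_exists Tr z).mpr ⟨t, ht, h⟩

/-- `Tr ≤ Tr ⊔ V[2]` and `V[2] ≤ Tr ⊔ V[2]` packaged: an element killed by `2` lies in `Tr ⊔ V[2]`. [folklore] -/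
theorem mem_sup_torsionBy_of_two_nsmul_eq_zero (Tr : AddSubgroup V) {z : V} (h : (2 : ℕ) • z = 0) :
    z ∈ Tr ⊔ AddSubgroup.torsionBy V 2 :=
  mem_sup_torsionBy_of_two_nsmul_eq Tr.zero_mem (by rw [h, smul_zero])

/-- **The `t`-terms vanish by bilinearity** (LEAD memo §8): if `Tr ≤ V` is ISOTROPIC for a bi-additive pairing `b` (`b t t' = 0`
for `t, t' ∈ Tr`), then for all `z, y ∈ M := Tr ⊔ V[2]` one has **`b (2•z) y = 0`**: writing `2•z = 2•t₁`, `2•y = 2•t₂` with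
`tᵢ ∈ Tr`, `b (2•z) y = b (2•t₁) y = b t₁ (2•y) = b t₁ (2•t₂) = 2 • b t₁ t₂ = 0`.  No Lagrangian or cyclicity hypothesis, no
complement `F` is needed. [cite: McCallumLMS1991, §5 Lemma 5.3 and proof of Prop. 5.2 (13)] -/
theorem pairing_two_nsmul_eq_zero_of_mem_sup_torsionBy (b : V →+ V →+ R) {Tr : AddSubgroup V}
    (hTr : ∀ t ∈ Tr, ∀ t' ∈ Tr, b t t' = 0) {z y : V}
    (hz : z ∈ Tr ⊔ AddSubgroup.torsionBy V 2) (hy : y ∈ Tr ⊔ AddSubgroup.torsionBy V 2) :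
    b ((2 : ℕ) • z) y = 0 := by
  obtain ⟨t₁, ht₁, h₁⟩ := (mem_sup_torsionBy_iff_exists Tr z).mp hz
  obtain ⟨t₂, ht₂, h₂⟩ := (mem_sup_torsionBy_iff_exists Tr y).mp hy
  calc b ((2 : ℕ) • z) y = b ((2 : ℕ) • t₁) y := by rw [h₁]
    _ = b t₁ ((2 : ℕ) • y) := by rw [map_nsmul, AddMonoidHom.nsmul_apply, map_nsmul]
    _ = b t₁ ((2 : ℕ) • t₂) := by rw [h₂]
    _ = (2 : ℕ) • b t₁ t₂ := map_nsmul _ _ _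
    _ = 0 := by rw [hTr t₁ ht₁ t₂ ht₂, smul_zero]

/-- The same with the factor `2` on the right: `b z (2•y) = 0` for `z, y ∈ Tr ⊔ V[2]`. [folklore] -/
theorem pairing_two_nsmul_right_eq_zero_of_mem_sup_torsionBy (b : V →+ V →+ R) {Tr : AddSubgroup V}
    (hTr : ∀ t ∈ Tr, ∀ t' ∈ Tr, b t t' = 0) {z y : V}
    (hz : z ∈ Tr ⊔ AddSubgroup.torsionBy V 2) (hy : y ∈ Tr ⊔ AddSubgroup.torsionBy V 2) :
    b z ((2 : ℕ) • y) = 0 := by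
  rw [map_nsmul, ← AddMonoidHom.nsmul_apply, ← map_nsmul]
  exact pairing_two_nsmul_eq_zero_of_mem_sup_torsionBy b hTr hz hy

/-- The `ℤ`-scalar form: `b (2•z) y = 0` with `(2 : ℤ) • z`. [folklore] -/
theorem pairing_two_zsmul_eq_zero_of_mem_sup_torsionBy (b : V →+ V →+ R) {Tr : AddSubgroup V}
    (hTr : ∀ t ∈ Tr, ∀ t' ∈ Tr, b t t' = 0) {z y : V}
    (hz : z ∈ Tr ⊔ AddSubgroup.torsionBy V 2) (hy : y ∈ Tr ⊔ AddSubgroup.torsionBy V 2) :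
    b ((2 : ℤ) • z) y = 0 := by
  rw [← Nat.cast_ofNat, natCast_zsmul]
  exact pairing_two_nsmul_eq_zero_of_mem_sup_torsionBy b hTr hz hy

end Vanishing

/-! ## §2 The order of `Tr ⊔ V[2]` -/

section Order

variable {V : Type*} [AddCommGroup V]

/-- **`8 ≤ #(Tr ⊔ V[2])`** as soon as `#Tr = 4` and some `2`-torsion element of `V` lies outside `Tr` (at a deep own prime: `#H¹_tr = 4`
and the non-zero element of `H¹_f[2]`, `H¹_f ∩ H¹_tr = 0`): a subgroup strictly containing `Tr` has order a proper multiple of `4`.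
[folklore] -/
theorem eight_le_natCard_sup_torsionBy [Finite V] (Tr : AddSubgroup V) (hTr : Nat.card Tr = 4)
    {v : V} (hv2 : (2 : ℕ) • v = 0) (hv : v ∉ Tr) :
    8 ≤ Nat.card ↥(Tr ⊔ AddSubgroup.torsionBy V 2) := by
  have hle : Tr ≤ Tr ⊔ AddSubgroup.torsionBy V 2 := le_sup_left
  have hdvd : Nat.card Tr ∣ Nat.card ↥(Tr ⊔ AddSubgroup.torsionBy V 2) := AddSubgroup.card_dvd_of_le hle
  rw [hTr] at hdvd
  obtain ⟨k, hk⟩ := hdvd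
  have hvM : v ∈ Tr ⊔ AddSubgroup.torsionBy V 2 := mem_sup_torsionBy_of_two_nsmul_eq_zero Tr hv2
  have hne : Tr ≠ Tr ⊔ AddSubgroup.torsionBy V 2 := fun h ↦ hv (h ▸ hvM)
  have hlt : Nat.card Tr < Nat.card ↥(Tr ⊔ AddSubgroup.torsionBy V 2) :=
    lt_of_not_ge fun h ↦ hne (AddSubgroup.eq_of_le_of_card_ge hle h)
  rw [hTr, hk] at hlt
  rw [hk]
  rcases k with _ | _ | k
  · omega
  · omega
  · nlinarith

/-- **`#(Tr ⊔ V[2]) ≤ 8`** when `#V = 16` and `Tr ⊔ V[2] ≠ ⊤` (at a deep own prime: an element of `H¹_f` of order `4` is not in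
`H¹_tr ⊕ H¹_f[2]`): a proper subgroup of a group of order `16` has order `≤ 8`. [folklore] -/
theorem natCard_sup_torsionBy_le_eight [Finite V] (hV : Nat.card V = 16) (Tr : AddSubgroup V)
    (hne : Tr ⊔ AddSubgroup.torsionBy V 2 ≠ ⊤) :
    Nat.card ↥(Tr ⊔ AddSubgroup.torsionBy V 2) ≤ 8 := by
  set M := Tr ⊔ AddSubgroup.torsionBy V 2 with hM
  have hdvd : Nat.card M ∣ 16 := hV ▸ AddSubgroup.card_addSubgroup_dvd_card M
  have hlt : Nat.card M < 16 := by
    rw [← hV]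
    exact lt_of_le_of_ne (AddSubgroup.card_le_card_addGroup M) fun h ↦ hne (AddSubgroup.eq_top_of_card_eq M h)
  obtain ⟨k, hk⟩ := hdvd
  have hpos : 0 < Nat.card M := Nat.card_pos
  rcases Nat.eq_or_lt_of_le (Nat.one_le_iff_ne_zero.mpr (by rintro rfl; omega : k ≠ 0)) with h1 | h2
  · rw [← h1, mul_one] at hk; omega
  · -- `k ≥ 2` ⟹ `#M = 16 / k ≤ 8`
    nlinarith

/-- A witness for `Tr ⊔ V[2] ≠ ⊤`: an element `f` with `2•f ∉ 2•Tr`-span, concretely `f ∉ Tr ⊔ V[2]`. [folklore] -/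
theorem sup_torsionBy_ne_top_of_not_mem (Tr : AddSubgroup V) {f : V} (hf : f ∉ Tr ⊔ AddSubgroup.torsionBy V 2) :
    Tr ⊔ AddSubgroup.torsionBy V 2 ≠ ⊤ := fun h ↦ hf (h ▸ AddSubgroup.mem_top f)

/-- `f ∉ Tr ⊔ V[2]` from: `2•f ≠ 2•t` for every `t ∈ Tr` (e.g. `f ∈ H¹_f` of order `4`, `H¹_f ∩ H¹_tr = 0`: `2•f = 2•t ∈ H¹_f ∩ H¹_tr`
forces `2•f = 0`). [folklore] -/
theorem not_mem_sup_torsionBy_of_forall_ne (Tr : AddSubgroup V) {f : V} (hf : ∀ t ∈ Tr, (2 : ℕ) • f ≠ 2 • t) :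
    f ∉ Tr ⊔ AddSubgroup.torsionBy V 2 := fun h ↦ by
  obtain ⟨t, ht, h2⟩ := (mem_sup_torsionBy_iff_exists Tr f).mp h
  exact hf t ht h2

/-- **`#(Tr ⊔ V[2]) = 8`** in the situation of a deep own prime, abstractly: `#V = 16`, `#Tr = 4`, `F ≤ V` with `F ⊓ Tr = ⊥` containing
an element `f` with `2•f ≠ 0` (then `2•f ∈ F ∖ Tr` is the `2`-torsion element outside `Tr`, and `f ∉ Tr ⊔ V[2]`). [folklore] -/
theorem natCard_sup_torsionBy_eq_eight [Finite V] (hV : Nat.card V = 16) (hV4 : ∀ v : V, (4 : ℕ) • v = 0)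
    (Tr F : AddSubgroup V) (hTr : Nat.card Tr = 4) (hdisj : Disjoint F Tr) {f : V} (hfF : f ∈ F) (hf2 : (2 : ℕ) • f ≠ 0) :
    Nat.card ↥(Tr ⊔ AddSubgroup.torsionBy V 2) = 8 := by
  -- `2•f ∈ F` is a `2`-torsion element outside `Tr` (`F ⊓ Tr = ⊥`, `2•f ≠ 0`)
  have h2fTr : (2 : ℕ) • f ∉ Tr := fun h2f ↦ by
    have hmem : (2 : ℕ) • f ∈ F ⊓ Tr := ⟨F.nsmul_mem hfF 2, h2f⟩
    rw [hdisj.eq_bot, AddSubgroup.mem_bot] at hmem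
    exact hf2 hmem
  have h4f : (2 : ℕ) • ((2 : ℕ) • f) = 0 := by rw [← mul_nsmul]; exact hV4 f
  -- `f ∉ Tr ⊔ V[2]`: `2•f = 2•t` with `t ∈ Tr` would put `2•f ∈ F ⊓ Tr`
  have hfM : f ∉ Tr ⊔ AddSubgroup.torsionBy V 2 :=
    not_mem_sup_torsionBy_of_forall_ne Tr fun t ht h ↦ h2fTr (h ▸ Tr.nsmul_mem ht 2)
  exact le_antisymm (natCard_sup_torsionBy_le_eight hV Tr (sup_torsionBy_ne_top_of_not_mem Tr hfM))
    (eight_le_natCard_sup_torsionBy Tr hTr h4f h2fTr)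

end Order

/-! ## §3 Duality: `{}^⊥(Tr ⊔ V[2]) ≤ Tr ⊔ V[2]` from `{}^⊥Tr = Tr` -/

section Duality

variable {V : Type*} [AddCommGroup V] {n : ℕ}

/-- **Coisotropy of `M = Tr ⊔ V[2]`**: if `{}^⊥Tr = Tr` (Lagrangian) then `{}^⊥M ≤ Tr ≤ M` — annihilators reverse inclusions. [folklore] -/
theorem annLeft_sup_torsionBy_le (b : V →+ V →+ ZMod n) (Tr : AddSubgroup V) (hTr : annLeft b Tr = Tr) :
    annLeft b (Tr ⊔ AddSubgroup.torsionBy V 2) ≤ Tr ⊔ AddSubgroup.torsionBy V 2 :=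
  ((annLeft_anti b (le_sup_left : Tr ≤ Tr ⊔ AddSubgroup.torsionBy V 2)).trans hTr.le).trans le_sup_left

/-- `{}^⊥(Tr ⊔ V[2]) ≤ Tr` under `{}^⊥Tr = Tr`. [folklore] -/
theorem annLeft_sup_torsionBy_le_self (b : V →+ V →+ ZMod n) (Tr : AddSubgroup V) (hTr : annLeft b Tr = Tr) :
    annLeft b (Tr ⊔ AddSubgroup.torsionBy V 2) ≤ Tr :=
  (annLeft_anti b (le_sup_left : Tr ≤ Tr ⊔ AddSubgroup.torsionBy V 2)).trans hTr.le

/-- `2•V ≤ {}^⊥(V[2])`: `b (2•x) y = b x (2•y) = 0` for `y ∈ V[2]`. [folklore] -/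
theorem two_nsmul_mem_annLeft_torsionBy (b : V →+ V →+ ZMod n) (x : V) :
    (2 : ℕ) • x ∈ annLeft b (AddSubgroup.torsionBy V 2) := by
  intro y hy
  have hy0 : (2 : ℕ) • y = 0 := by
    have := (Submodule.mem_torsionBy_iff (R := ℤ) (2 : ℤ) y).mp hy
    rwa [← natCast_zsmul, Nat.cast_ofNat]
  rw [map_nsmul, AddMonoidHom.nsmul_apply, ← map_nsmul, hy0, map_zero]

/-- `{}^⊥(Tr ⊔ V[2]) = {}^⊥Tr ⊓ {}^⊥(V[2])`; with `{}^⊥Tr = Tr` its elements are the `t ∈ Tr` pairing trivially with all of `V[2]`.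
[folklore] -/
theorem annLeft_sup_torsionBy_eq (b : V →+ V →+ ZMod n) (Tr : AddSubgroup V) (hTr : annLeft b Tr = Tr) :
    annLeft b (Tr ⊔ AddSubgroup.torsionBy V 2) = Tr ⊓ annLeft b (AddSubgroup.torsionBy V 2) := by
  rw [annLeft_sup, hTr]

/-- **Isotropic of half order ⟹ Lagrangian**: for a pairing whose left adjoint is bijective on a finite `V` killed by `n`, an
ISOTROPIC `Tr` with `#Tr · #Tr = #V` satisfies `{}^⊥Tr = Tr` (`Tr ≤ {}^⊥Tr` and `#{}^⊥Tr · #Tr = #V`).  At a deep own prime: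
`#H¹_tr = 4`, `#H¹(ℚ_ℓ, E^ε[4]) = 16`. [cite: MilneADT2006, Ch. I, Prop. 0.19] -/
theorem annLeft_eq_self_of_isotropic_of_card [Finite V] [NeZero n] (hV : ∀ x : V, n • x = 0) (b : V →+ V →+ ZMod n)
    (hb : Bijective b) (Tr : AddSubgroup V) (hiso : ∀ t ∈ Tr, ∀ t' ∈ Tr, b t t' = 0)
    (hcard : Nat.card Tr * Nat.card Tr = Nat.card V) :
    annLeft b Tr = Tr := by
  have hle : Tr ≤ annLeft b Tr := fun t ht t' ht' ↦ hiso t ht t' ht'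
  symm
  refine AddSubgroup.eq_of_le_of_card_ge hle (le_of_eq ?_)
  have h := natCard_annLeft_mul hV b hb Tr
  have hpos : 0 < Nat.card Tr := Nat.card_pos
  refine Nat.eq_of_mul_eq_mul_right hpos ?_
  rw [h, hcard]

/-- **Order of the dual condition**: `#{}^⊥M · #M = #V`, so `#{}^⊥(Tr ⊔ V[2]) = 2` when `#V = 16` and `#(Tr ⊔ V[2]) = 8` (the
«`(H′_ℓ)^⊥` of order 2» of the LEAD's dual solution group `𝒴₄*`). [folklore] -/
theorem natCard_annLeft_sup_torsionBy_eq_two [Finite V] [NeZero n] (hV : ∀ x : V, n • x = 0) (b : V →+ V →+ ZMod n)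
    (hb : Bijective b) (hV16 : Nat.card V = 16) (Tr : AddSubgroup V)
    (hM : Nat.card ↥(Tr ⊔ AddSubgroup.torsionBy V 2) = 8) :
    Nat.card ↥(annLeft b (Tr ⊔ AddSubgroup.torsionBy V 2)) = 2 := by
  have h := natCard_annLeft_mul hV b hb (Tr ⊔ AddSubgroup.torsionBy V 2)
  rw [hM, hV16] at h
  omega

end Duality

end Summit.BirchSwinnertonDyer.BirchSwinnertonDyer.Theorems.GenusExact.CoisotropicEight
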